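import Summits.QuantumFields.BalabanUV.Beta.GAN24.LegPushDressedBound
import Summits.QuantumFields.BalabanUV.Beta.GAN24.LegPushGaugePairingsBlockL1
import Summits.QuantumFields.BalabanUV.Beta.GAN24.LegPushBlockL1

/-!
# `BalabanUV.Beta.GAN24.LegPushDressedBoundBlockL1` — binder row G-an2-4 ∕ (CONV-C), W-slot, the (α-0) parity re-cut, located crux (Q-L-k₀) (RULING R-gan24p1-g36-1 (4a)/(4d)):
# **THE (E-a) WINDOW AND THE k₀-FOLD DRESSED WINDOW WITH THE KERNEL LEG IN BLOCK MASS** — `LegPushDressedBound` ∕ `LegChainPushDressed` VERBATIM (statements and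
constants) except that the kernel leg is only asked to have block mass `Σ_{t∈box L} |ℓ α x′ f (L•c + t)| ≤ a_ρ·L^{d+1}·e^{−κ₀‖c − x′‖∞}` — the OWNER gan24-p1 g36's
currency (`LegPushBlockL1`, `ThreeLegSupBoundBlockL1`; his `DressedLegBlockL1Envelope` ∕ `DressedLegMultiplierColumnEnvelope` give `a_ρ·L^{d+1} = K·(k+1)·L^{−1}` at
`d = 3` for the DRESSED composite kernel leg, one power of `L` below any sup reading).  With this file NOTHING on the (H1♮) window is sup-priced in the kernel leg.

NOT IN PRINT; OUR PROOF ([folklore] bookkeeping; 0 `def`, 0 cited facts, 0 `def … : Prop`, 0 sorry, 0 wall binders).  HONEST FRAMING (cell contract, verbatim):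
«discharging `BetaPertH` makes Bałaban's UV stability UNCONDITIONAL — a real constructive-QFT result; it is NOT the continuum limit and NOT the Clay problem.»
HONEST DEPENDENCY (verbatim): «continuum YM on T⁴ ⇐ BetaPertH ∧ nine spine estimates (0/9 proved); BetaPertH ⇐ (D1) ∧ (D4) ∧ CAP+tail; G-an2-4 gates asym, D1 and NE2/3/4.»
* **`abs_gaugeLayer_le_of_blockL1`**, **`abs_legPush_dressed_sub_inl_le_of_blockL1`**, **`locStencil₂_legPush_dressed_of_bare_of_blockL1`** (gauge side; the entry identity
  `LegPushDressedBound.vertex2W_dressed_bsum_entry` and helpers reused; pairings from `LegPushGaugePairingsBlockL1`);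
* **`locStencil₂_legPush_dressed_bsum_of_blockL1`** (the (E-a) window; bare part = the OWNER's `LegPushBlockL1.abs_legPush_bsum_inl_le_of_blockL1`);
* **`locStencil₂_legChain_bsumPow_of_dressed_envelopes_of_blockL1`** (the k₀-fold window modulo envelopes: composite dressed slot legs `= r + d_zφ`, composite kernel leg in
  block mass).
What remains for (H1♮): the identification `hE` with leaf-12's (b1) envelopes and MY g57 `Psi` envelope ((E-c)), the OWNER's dressed-kernel block masses fed to `hl₁`
((E-b), his p367009 ∕ p368145 ∕ staged), `LegChainPushDressed.abs_prod_kcPin_le` + `LegWindowArithmetic` p368022 ✓ for `θ < 1`, and the socket call ((E-d)).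
NOT (H1♮); NEVER «G-an2-4 closed» as (CONV-C); NOT D1, NOT `BetaPertH`, NOT continuum, NOT Clay; not in print.
Unit `b2b-balaban-gan24-formalise-leaf-01` (G-an2-4 formalisation swarm, leaf prover 01, gen 74), 2026-08-23.
-/

noncomputable section

open Finset
open scoped BigOperators
open Literature.MathematicalPhysics.QuantumFieldTheory.LatticeForm (quo)
open Literature.MathematicalPhysics.QuantumFieldTheory.Balaban1983to89
open Literature.MathematicalPhysics.QuantumFieldTheory.Balaban1983to89.Beta
open B4ContourShift (supNorm)
open B6BondElimination (unitVec)
open B12Sec2to5 (l1 l1_nonneg)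
open ExpKernelCalculus (MKer Zl Zl_nonneg Zl_pos l1_sub_triangle l1_sub_symm)
open OneStepResolventKernel (Fib)
open AffineAveraging (box toSite)
open KernelWard (divV)
open Summit.QuantumFields.BalabanUV.Beta.GAN24.BiStencilZeroMode (Tab)
open Summit.QuantumFields.BalabanUV.Beta.GAN24.Push4 (vertexW vertexW_apply vertex2W)
open BalabanCompositeJets (LocStencil₂ LocStencil₂.nonneg)
open Summit.QuantumFields.BalabanUV.Beta.GAN24.LegStepPush (abs_legPush_bsum_inl_le)
open Summit.QuantumFields.BalabanUV.Beta.GAN24.LegStepPush (legPush legPush_inl legPush_inr supNorm_sub_comm)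
open Summit.QuantumFields.BalabanUV.Beta.GAN24.LegPushNestAux (abs_vertexW_le_of_bdd)
open Summit.QuantumFields.BalabanUV.Beta.GAN24.LegPushGaugeSplit (vertex2W_dressed_eq)
open Summit.QuantumFields.BalabanUV.Beta.GAN24.ThreeLegDoubleFreezeSummable (locStencil₂_of_env_bound)
open B4Reflection242 (supNorm_add_le)
open B4ContourShift (supNorm_nonneg)
open Summit.QuantumFields.BalabanUV.Beta.GAN24.Lin4LegTower (bsum bsum_apply)
open Summit.QuantumFields.BalabanUV.Beta.GAN24.EnvelopeBlockSum (env_le_one summable_env)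
open Summit.QuantumFields.BalabanUV.Beta.GAN24.LegPushGaugeSplit (divV_apply_entry)
open Summit.QuantumFields.BalabanUV.Beta.GAN24.ThreeLegSupBound (middle_sup_le abs_threeLeg_sup_le)

open Summit.QuantumFields.BalabanUV.Beta.GAN24.LegPushGaugePairings (divV_bsum_entry summable_env_mul abs_pairingA_le abs_pairingB_le abs_pairingC_le)

open ExpKernelCalculus (Decays)
open OneStepKernelFamily (colH)
open AveragingContours (blk)
open BalabanStepW2 (locStencil₂_smul')
open Summit.QuantumFields.BalabanUV.Beta.GAN24.Lin4LegTowerUnroll (bsumPow)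
open Summit.QuantumFields.BalabanUV.Beta.GAN24.LegStepPush (krow)
open Summit.QuantumFields.BalabanUV.Beta.GAN24.LegChainPush (kChain)
open Summit.QuantumFields.BalabanUV.Beta.GAN24.LegChainPushBound (legChain_bsumPow_eq_smul_legPush_bsum)
open Summit.QuantumFields.BalabanUV.Beta.GAN24.ThreeLegSupBoundBlockL1 (abs_le_blockSum)
open Summit.QuantumFields.BalabanUV.Beta.GAN24.LegPushBlockL1 (abs_legPush_bsum_inl_le_of_blockL1)
open Summit.QuantumFields.BalabanUV.Beta.GAN24.LegPushGaugePairingsBlockL1 (abs_pairingA_le_of_blockL1 abs_pairingB_le_of_blockL1 abs_pairingC_le_of_blockL1)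
open Summit.QuantumFields.BalabanUV.Beta.GAN24.LegPushDressedBound (summable_mul_of_bdd abs_tsum_mul_le_of_bdd abs_divV_le_of_bdd summable_of_env vertex2W_dressed_bsum_entry)

namespace Summit.QuantumFields.BalabanUV.Beta.GAN24.LegPushDressedBoundBlockL1

variable {d : ℕ}

section DressedBlockL1

variable {L : ℕ} {κ₀ δ a aφ aρ g' CW : ℝ}
  {l : Fin (d + 1) → (Fin (d + 1) → ℤ) → Fib d → (Fin (d + 1) → ℤ) → ℝ}
  {r : Fin (d + 1) → (Fin (d + 1) → ℤ) → Fin (d + 1) → (Fin (d + 1) → ℤ) → ℝ}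
  {φ : Fin (d + 1) → (Fin (d + 1) → ℤ) → (Fin (d + 1) → ℤ) → ℝ} {W : Tab d}
  (hL : 1 ≤ L) (hκ : 0 < κ₀) (hδ : 0 < δ) (hgap : κ₀ ≤ δ / 6 * L)
  (ha : 0 ≤ a) (haφ : 0 ≤ aφ) (haρ : 0 ≤ aρ) (hg : 0 ≤ g')
  (hr : ∀ μ y κ v, |r μ y κ v| ≤ a * Real.exp (-(κ₀ * supNorm (quo L v - y))))
  (hφ : ∀ μ y v, |φ μ y v| ≤ aφ * Real.exp (-(κ₀ * supNorm (quo L v - y))))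
  (hl₁ : ∀ α x' f c, ∑ t ∈ box (d + 1) L, |l α x' f ((L : ℤ) • c + toSite t)| ≤ aρ * (L : ℝ) ^ (d + 1) * Real.exp (-(κ₀ * supNorm (c - x'))))
  (hWb : ∀ κ u κ' u' x z a b, |W κ u κ' u' x z a b| ≤ CW)
  (hD₂ : ∀ κ v w x p f b, |∑ μ, (W κ v μ (w - unitVec μ) x p f b - W κ v μ w x p f b)|
    ≤ g' * Real.exp (-δ * l1 (w - v)) * Real.exp (-δ * (l1 (x - v) + l1 (p - v))))
  (hD₁ : ∀ κ' w v' x p f b, |∑ κ, (W κ (w - unitVec κ) κ' v' x p f b - W κ w κ' v' x p f b)|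
    ≤ g' * Real.exp (-δ * l1 (v' - w)) * Real.exp (-δ * (l1 (x - w) + l1 (p - w))))

include hL hκ hδ hgap ha haφ haρ hg hr hφ in
/-- NOT IN PRINT; OUR PROOF.  **THE GAUGE LAYER OF ONE ORDERING IS A `Cg·g′` TERM**: the kernel leg row `l α x′ f` against `A + B + C` of
`vertex2W_dressed_bsum_entry`: `|Σ'_x l α x′ f x·(A+B+C)(x)| ≤ a_ρ·g′·(d+1)·(2·a·a_φ + a_φ²·(e^{3δ}+1))·K₀·e^{−(κ₀/6)(‖y′−y‖∞+‖x′−y‖∞+‖z−y‖∞)}`,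
`K₀ = e^{5κ₀}·Zl(δ/2)³·L^{d+1}·Zl(κ₀/(2(d+1)))` (summable summand). -/
theorem abs_gaugeLayer_le_of_blockL1
    (hl₁ : ∀ α x' f c, ∑ t ∈ box (d + 1) L, |l α x' f ((L : ℤ) • c + toSite t)| ≤ aρ * (L : ℝ) ^ (d + 1) * Real.exp (-(κ₀ * supNorm (c - x'))))
    (hWb : ∀ κ u κ' u' x z a b, |W κ u κ' u' x z a b| ≤ CW)
    (hD₂ : ∀ κ v w x p f b, |∑ μ, (W κ v μ (w - unitVec μ) x p f b - W κ v μ w x p f b)|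
      ≤ g' * Real.exp (-δ * l1 (w - v)) * Real.exp (-δ * (l1 (x - v) + l1 (p - v))))
    (hD₁ : ∀ κ' w v' x p f b, |∑ κ, (W κ (w - unitVec κ) κ' v' x p f b - W κ w κ' v' x p f b)|
      ≤ g' * Real.exp (-δ * l1 (v' - w)) * Real.exp (-δ * (l1 (x - w) + l1 (p - w))))
    (μ : Fin (d + 1)) (y : Fin (d + 1) → ℤ) (ν : Fin (d + 1)) (y' : Fin (d + 1) → ℤ)
    (α : Fin (d + 1)) (x' z : Fin (d + 1) → ℤ) (f b : Fib d) :
    (Summable fun x => l α x' f x *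
      (vertexW r (fun κ u => fun x z f b => ∑' w', φ ν y' w' * divV (fun μ' w'' => bsum L (W κ u μ' w'')) w' x z f b) μ y x z f b
        + ∑' w, φ μ y w * divV (fun κ u => vertexW r (fun μ' w'' => bsum L (W κ u μ' w'')) ν y') w x z f b
        + ∑' w, φ μ y w * divV (fun κ u => fun x z f b => ∑' w', φ ν y' w' * divV (fun μ' w'' => bsum L (W κ u μ' w'')) w' x z f b) w x z f b)) ∧
    |∑' x, l α x' f x *
      (vertexW r (fun κ u => fun x z f b => ∑' w', φ ν y' w' * divV (fun μ' w'' => bsum L (W κ u μ' w'')) w' x z f b) μ y x z f b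
        + ∑' w, φ μ y w * divV (fun κ u => vertexW r (fun μ' w'' => bsum L (W κ u μ' w'')) ν y') w x z f b
        + ∑' w, φ μ y w * divV (fun κ u => fun x z f b => ∑' w', φ ν y' w' * divV (fun μ' w'' => bsum L (W κ u μ' w'')) w' x z f b) w x z f b)|
      ≤ aρ * g' * (((d : ℝ) + 1) * (2 * (a * aφ) + aφ * aφ * (Real.exp δ ^ 3 + 1))) *
        (Real.exp κ₀ ^ 5 * Zl (d + 1) (δ / 2) ^ 3 * ((L : ℝ) ^ (d + 1) * Zl (d + 1) (κ₀ / (2 * ((d : ℝ) + 1))))) *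
          Real.exp (-(κ₀ / 6) * (supNorm (y' - y) + supNorm (x' - y) + supNorm (z - y))) := by
  have pA := abs_pairingA_le_of_blockL1 (r := r) (φ := φ) (W := W) (ρ := fun x => l α x' f x) (μ₀ := μ) (y₀ := y) (ν₀ := ν) (y₀' := y') (x' := x') (y := z) (f := f) (b := b)
    hL hκ hδ hgap ha haφ haρ hg (fun κ v => hr μ y κ v) (fun w => hφ ν y' w) (hl₁ α x' f) (fun κ v w x p => hD₂ κ v w x p f b)
  have pB := abs_pairingB_le_of_blockL1 (r := r) (φ := φ) (W := W) (ρ := fun x => l α x' f x) (μ₀ := μ) (y₀ := y) (ν₀ := ν) (y₀' := y') (x' := x') (y := z) (f := f) (b := b)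
    hL hκ hδ hgap ha haφ haρ hg (fun w => hφ μ y w) (fun κ v => hr ν y' κ v) (hl₁ α x' f) hWb (fun κ' w v' x p => hD₁ κ' w v' x p f b)
  have pC := abs_pairingC_le_of_blockL1 (φ := φ) (W := W) (ρ := fun x => l α x' f x) (μ₀ := μ) (y₀ := y) (ν₀ := ν) (y₀' := y') (x' := x') (y := z) (f := f) (b := b)
    hL hκ hδ hgap haφ haφ haρ hg (fun w => hφ μ y w) (fun w' => hφ ν y' w') (hl₁ α x' f) hWb (fun κ v w x p => hD₂ κ v w x p f b)
  have esplit : ∀ x, l α x' f x *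
      (vertexW r (fun κ u => fun x z f b => ∑' w', φ ν y' w' * divV (fun μ' w'' => bsum L (W κ u μ' w'')) w' x z f b) μ y x z f b
        + ∑' w, φ μ y w * divV (fun κ u => vertexW r (fun μ' w'' => bsum L (W κ u μ' w'')) ν y') w x z f b
        + ∑' w, φ μ y w * divV (fun κ u => fun x z f b => ∑' w', φ ν y' w' * divV (fun μ' w'' => bsum L (W κ u μ' w'')) w' x z f b) w x z f b)
      = l α x' f x * vertexW r (fun κ u => fun x z f b => ∑' w', φ ν y' w' * divV (fun μ' w'' => bsum L (W κ u μ' w'')) w' x z f b) μ y x z f b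
        + l α x' f x * ∑' w, φ μ y w * divV (fun κ u => vertexW r (fun μ' w'' => bsum L (W κ u μ' w'')) ν y') w x z f b
        + l α x' f x * ∑' w, φ μ y w *
            divV (fun κ u => fun x z f b => ∑' w', φ ν y' w' * divV (fun μ' w'' => bsum L (W κ u μ' w'')) w' x z f b) w x z f b := fun x => by ring
  simp_rw [esplit]
  refine ⟨(pA.1.add pB.1).add pC.1, ?_⟩
  rw [(pA.1.add pB.1).tsum_add pC.1, pA.1.tsum_add pB.1]
  have h3 := (abs_add_le _ _).trans (add_le_add ((abs_add_le _ _).trans (add_le_add pA.2 pB.2)) pC.2)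
  refine h3.trans (le_of_eq ?_)
  ring

include hL hκ hδ hgap ha haφ haρ hg hr hφ in
/-- NOT IN PRINT; OUR PROOF.  **DRESSING BOTH SLOT LEGS COSTS A `Cg·g′` TERM PER ENTRY** (field rows): `|legPush l (r + d_zφ) (bsum L ∘ W) κ u κ′ u′ x′ z (inl α) b
− legPush l r (bsum L ∘ W) κ u κ′ u′ x′ z (inl α) b| ≤ |Fib d|·a_ρ·g′·(d+1)·(2·a·a_φ + a_φ²·(e^{3δ}+1))·K₀·e^{−(κ₀/18)(‖u′−u‖∞+‖x′−u‖∞+‖z−u‖∞)}` (both orderings of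
the symmetrisation; the swapped one is centred at the other slot, whence `κ₀/18`). -/
theorem abs_legPush_dressed_sub_inl_le_of_blockL1
    (hl₁ : ∀ α x' f c, ∑ t ∈ box (d + 1) L, |l α x' f ((L : ℤ) • c + toSite t)| ≤ aρ * (L : ℝ) ^ (d + 1) * Real.exp (-(κ₀ * supNorm (c - x'))))
    (hWb : ∀ κ u κ' u' x z a b, |W κ u κ' u' x z a b| ≤ CW)
    (hD₂ : ∀ κ v w x p f b, |∑ μ, (W κ v μ (w - unitVec μ) x p f b - W κ v μ w x p f b)|
      ≤ g' * Real.exp (-δ * l1 (w - v)) * Real.exp (-δ * (l1 (x - v) + l1 (p - v))))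
    (hD₁ : ∀ κ' w v' x p f b, |∑ κ, (W κ (w - unitVec κ) κ' v' x p f b - W κ w κ' v' x p f b)|
      ≤ g' * Real.exp (-δ * l1 (v' - w)) * Real.exp (-δ * (l1 (x - w) + l1 (p - w))))
    (κ : Fin (d + 1)) (u : Fin (d + 1) → ℤ) (κ' : Fin (d + 1)) (u' : Fin (d + 1) → ℤ)
    (x' z : Fin (d + 1) → ℤ) (α : Fin (d + 1)) (b : Fib d) :
    |legPush l (fun μ y κ v => r μ y κ v + (φ μ y (v + unitVec κ) - φ μ y v)) (fun κ₁ v κ₂ v' => bsum L (W κ₁ v κ₂ v')) κ u κ' u' x' z (Sum.inl α) b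
      - legPush l r (fun κ₁ v κ₂ v' => bsum L (W κ₁ v κ₂ v')) κ u κ' u' x' z (Sum.inl α) b|
      ≤ (Fintype.card (Fib d) : ℝ) * (aρ * g' * (((d : ℝ) + 1) * (2 * (a * aφ) + aφ * aφ * (Real.exp δ ^ 3 + 1))) *
        (Real.exp κ₀ ^ 5 * Zl (d + 1) (δ / 2) ^ 3 * ((L : ℝ) ^ (d + 1) * Zl (d + 1) (κ₀ / (2 * ((d : ℝ) + 1)))))) *
          Real.exp (-(κ₀ / 18) * (supNorm (u' - u) + supNorm (x' - u) + supNorm (z - u))) := by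
  set KG : ℝ := aρ * g' * (((d : ℝ) + 1) * (2 * (a * aφ) + aφ * aφ * (Real.exp δ ^ 3 + 1))) *
        (Real.exp κ₀ ^ 5 * Zl (d + 1) (δ / 2) ^ 3 * ((L : ℝ) ^ (d + 1) * Zl (d + 1) (κ₀ / (2 * ((d : ℝ) + 1))))) with hKG
  have hZ2 := Zl_nonneg (D := d + 1) (show 0 < δ / 2 by positivity)
  have hZκ := Zl_nonneg (D := d + 1) (show 0 < κ₀ / (2 * ((d : ℝ) + 1)) by positivity)
  have hKG0 : 0 ≤ KG := by rw [hKG]; positivity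
  set S : ℝ := supNorm (u' - u) + supNorm (x' - u) + supNorm (z - u) with hS
  -- the gauge layers of the two orderings
  obtain ⟨G, hGdef⟩ : ∃ G : Fin (d + 1) → (Fin (d + 1) → ℤ) → Fin (d + 1) → (Fin (d + 1) → ℤ) → (Fin (d + 1) → ℤ) → Fib d → ℝ,
      G = fun μ y ν y' x f =>
        vertexW r (fun κ u => fun x z f b => ∑' w', φ ν y' w' * divV (fun μ' w'' => bsum L (W κ u μ' w'')) w' x z f b) μ y x z f b
          + ∑' w, φ μ y w * divV (fun κ u => vertexW r (fun μ' w'' => bsum L (W κ u μ' w'')) ν y') w x z f b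
          + ∑' w, φ μ y w * divV (fun κ u => fun x z f b => ∑' w', φ ν y' w' * divV (fun μ' w'' => bsum L (W κ u μ' w'')) w' x z f b) w x z f b :=
    ⟨_, rfl⟩
  have gl : ∀ μ y ν y' f, (Summable fun x => l α x' f x * G μ y ν y' x f) ∧
      |∑' x, l α x' f x * G μ y ν y' x f| ≤ KG * Real.exp (-(κ₀ / 6) * (supNorm (y' - y) + supNorm (x' - y) + supNorm (z - y))) := by
    intro μ y ν y' f
    have h := abs_gaugeLayer_le_of_blockL1 hL hκ hδ hgap ha haφ haρ hg hr hφ hl₁ hWb hD₂ hD₁ μ y ν y' α x' z f b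
    rw [hKG]
    subst hGdef
    exact h
  -- the base layers are summable (bounded double vertex against the kernel-leg envelope)
  have hrs : ∀ μ y κ, Summable fun v => r μ y κ v := fun μ y κ => summable_of_env hL hκ (hr μ y κ)
  have hXb : ∀ κ u κ' u' x z a b, |bsum L (W κ u κ' u') x z a b| ≤ (box (d + 1) L).card * CW := by
    intro κ u κ' u' x z a b
    rw [bsum_apply]
    refine (Finset.abs_sum_le_sum_abs _ _).trans ((Finset.sum_le_sum fun t _ => hWb κ u κ' u' x _ a b).trans (le_of_eq ?_))
    rw [Finset.sum_const, nsmul_eq_mul]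
  have BV : ∀ μ y ν y' x f, |vertex2W r (fun κ₁ v κ₂ v' => bsum L (W κ₁ v κ₂ v')) μ y ν y' x z f b|
      ≤ (∑ κ₁, ∑' v, |r μ y κ₁ v|) * ((∑ κ₂, ∑' v', |r ν y' κ₂ v'|) * ((box (d + 1) L).card * CW)) := by
    intro μ y ν y' x f
    simp only [vertex2W]
    exact abs_vertexW_le_of_bdd (r := r) (T := fun κ w => vertexW r (fun κ₂ v' => bsum L (W κ w κ₂ v')) ν y') hrs (fun κ w x z a b =>
      abs_vertexW_le_of_bdd (r := r) (T := fun κ₂ v' => bsum L (W κ w κ₂ v')) hrs (fun lam v w₁ z₁ f₁ b₁ => hXb κ w lam v w₁ z₁ f₁ b₁) ν y' x z a b) μ y x z f b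
  haveI : NeZero L := ⟨by omega⟩
  have hlx : ∀ α₀ (x₀ : Fin (d + 1) → ℤ) f₀ x, |l α₀ x₀ f₀ x| ≤ aρ * (L : ℝ) ^ (d + 1) * Real.exp (-(κ₀ * supNorm (quo L x - x₀))) :=
    fun α₀ x₀ f₀ x => (abs_le_blockSum hL (fun x => l α₀ x₀ f₀ x) x).trans (hl₁ α₀ x₀ f₀ (blk L x))
  have bl : ∀ μ y ν y' f, Summable fun x => l α x' f x * vertex2W r (fun κ₁ v κ₂ v' => bsum L (W κ₁ v κ₂ v')) μ y ν y' x z f b :=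
    fun μ y ν y' f => summable_env_mul hL hκ (hlx α x' f) (fun x => BV μ y ν y' x f)
  -- the dressed entry = base entry + gauge entry
  have eI : ∀ x, ∑ f, l α x' f x * ((1 / 2 : ℝ) *
        (vertex2W (fun μ y κ v => r μ y κ v + (φ μ y (v + unitVec κ) - φ μ y v)) (fun κ₁ v κ₂ v' => bsum L (W κ₁ v κ₂ v')) κ u κ' u' x z f b
          + vertex2W (fun μ y κ v => r μ y κ v + (φ μ y (v + unitVec κ) - φ μ y v)) (fun κ₁ v κ₂ v' => bsum L (W κ₁ v κ₂ v')) κ' u' κ u x z f b))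
      = ∑ f, l α x' f x * ((1 / 2 : ℝ) * (vertex2W r (fun κ₁ v κ₂ v' => bsum L (W κ₁ v κ₂ v')) κ u κ' u' x z f b
          + vertex2W r (fun κ₁ v κ₂ v' => bsum L (W κ₁ v κ₂ v')) κ' u' κ u x z f b))
        + ∑ f, (1 / 2 : ℝ) * (l α x' f x * G κ u κ' u' x f + l α x' f x * G κ' u' κ u x f) := by
    intro x
    rw [← Finset.sum_add_distrib]
    refine Finset.sum_congr rfl fun f _ => ?_
    rw [vertex2W_dressed_bsum_entry hL hκ hr hφ hWb κ u κ' u' x z f b, vertex2W_dressed_bsum_entry hL hκ hr hφ hWb κ' u' κ u x z f b]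
    subst hGdef
    ring
  have hSb : Summable fun x => ∑ f, l α x' f x * ((1 / 2 : ℝ) * (vertex2W r (fun κ₁ v κ₂ v' => bsum L (W κ₁ v κ₂ v')) κ u κ' u' x z f b
      + vertex2W r (fun κ₁ v κ₂ v' => bsum L (W κ₁ v κ₂ v')) κ' u' κ u x z f b)) := by
    refine summable_sum fun f _ => ?_
    have h := ((bl κ u κ' u' f).add (bl κ' u' κ u f)).mul_left (1 / 2 : ℝ)
    refine h.congr fun x => ?_
    ring
  have hSg : ∀ f, Summable fun x => (1 / 2 : ℝ) * (l α x' f x * G κ u κ' u' x f + l α x' f x * G κ' u' κ u x f) :=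
    fun f => ((gl κ u κ' u' f).1.add (gl κ' u' κ u f).1).mul_left _
  rw [legPush_inl, legPush_inl]
  simp_rw [eI]
  rw [hSb.tsum_add (summable_sum fun f _ => hSg f), add_sub_cancel_left]
  -- the two decays against the symmetric rate `κ₀/18`
  have hdec₁ : Real.exp (-(κ₀ / 6) * (supNorm (u' - u) + supNorm (x' - u) + supNorm (z - u))) ≤ Real.exp (-(κ₀ / 18) * S) := by
    rw [Real.exp_le_exp, hS]
    have := supNorm_nonneg (u' - u); have := supNorm_nonneg (x' - u); have := supNorm_nonneg (z - u)
    nlinarith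
  have hdec₂ : Real.exp (-(κ₀ / 6) * (supNorm (u - u') + supNorm (x' - u') + supNorm (z - u'))) ≤ Real.exp (-(κ₀ / 18) * S) := by
    rw [Real.exp_le_exp, hS]
    have h1 := supNorm_add_le (x' - u') (u' - u)
    have h2 := supNorm_add_le (z - u') (u' - u)
    rw [show x' - u' + (u' - u) = x' - u by abel] at h1
    rw [show z - u' + (u' - u) = z - u by abel] at h2
    have h3 := supNorm_sub_comm u u'
    have := supNorm_nonneg (u - u'); have := supNorm_nonneg (x' - u'); have := supNorm_nonneg (z - u')
    nlinarith
  have hterm : ∀ f, |∑' x, (1 / 2 : ℝ) * (l α x' f x * G κ u κ' u' x f + l α x' f x * G κ' u' κ u x f)| ≤ KG * Real.exp (-(κ₀ / 18) * S) := by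
    intro f
    rw [tsum_mul_left, (gl κ u κ' u' f).1.tsum_add (gl κ' u' κ u f).1, abs_mul, abs_of_pos (by norm_num : (0 : ℝ) < 1 / 2)]
    have h1 := (gl κ u κ' u' f).2.trans (mul_le_mul_of_nonneg_left hdec₁ hKG0)
    have h2 := (gl κ' u' κ u f).2.trans (mul_le_mul_of_nonneg_left hdec₂ hKG0)
    have h12 := (abs_add_le _ _).trans (add_le_add h1 h2)
    linarith
  rw [Summable.tsum_finsetSum (fun f _ => hSg f)]
  calc |∑ f, ∑' x, (1 / 2 : ℝ) * (l α x' f x * G κ u κ' u' x f + l α x' f x * G κ' u' κ u x f)|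
      ≤ ∑ f, |∑' x, (1 / 2 : ℝ) * (l α x' f x * G κ u κ' u' x f + l α x' f x * G κ' u' κ u x f)| := Finset.abs_sum_le_sum_abs _ _
    _ ≤ ∑ _f : Fib d, KG * Real.exp (-(κ₀ / 18) * S) := Finset.sum_le_sum fun f _ => hterm f
    _ = _ := by simp only [Finset.sum_const, Finset.card_univ, nsmul_eq_mul, hKG, hS]; ring

include hL hκ hδ hgap ha haφ haρ hg hr hφ in
/-- NOT IN PRINT; OUR PROOF.  **THE DRESSED ONE-PUSH `LocStencil₂` BOUND, GIVEN THE BARE ONE**: if the bare push obeys the envelope bound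
`|legPush l r (bsum L ∘ W) κ u κ′ u′ x z (inl α) b| ≤ CB·e^{−(κ₀/18)·spread}` (e.g. `LegStepPush.abs_legPush_bsum_inl_le`), then
`LocStencil₂ (legPush l (r + d_zφ) (bsum L ∘ W)) (CB + |Fib d|·a_ρ·g′·(d+1)·(2a·a_φ + a_φ²(e^{3δ}+1))·K₀) (κ₀/(18(d+1)))` — the (E-a) window:
dressing the slot legs adds only `Cg(k₀)·g′` (slot-DIVERGENCE rows) to the constant, never a multiple of the table's `LocStencil₂` constant. -/
theorem locStencil₂_legPush_dressed_of_bare_of_blockL1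
    (hl₁ : ∀ α x' f c, ∑ t ∈ box (d + 1) L, |l α x' f ((L : ℤ) • c + toSite t)| ≤ aρ * (L : ℝ) ^ (d + 1) * Real.exp (-(κ₀ * supNorm (c - x'))))
    (hWb : ∀ κ u κ' u' x z a b, |W κ u κ' u' x z a b| ≤ CW)
    (hD₂ : ∀ κ v w x p f b, |∑ μ, (W κ v μ (w - unitVec μ) x p f b - W κ v μ w x p f b)|
      ≤ g' * Real.exp (-δ * l1 (w - v)) * Real.exp (-δ * (l1 (x - v) + l1 (p - v))))
    (hD₁ : ∀ κ' w v' x p f b, |∑ κ, (W κ (w - unitVec κ) κ' v' x p f b - W κ w κ' v' x p f b)|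
      ≤ g' * Real.exp (-δ * l1 (v' - w)) * Real.exp (-δ * (l1 (x - w) + l1 (p - w))))
    {CB : ℝ} (hCB : 0 ≤ CB)
    (hB : ∀ κ u κ' u' x z α b, |legPush l r (fun κ₁ v κ₂ v' => bsum L (W κ₁ v κ₂ v')) κ u κ' u' x z (Sum.inl α) b|
      ≤ CB * Real.exp (-(κ₀ / 18) * (supNorm (u' - u) + supNorm (x - u) + supNorm (z - u)))) :
    LocStencil₂ (legPush l (fun μ y κ v => r μ y κ v + (φ μ y (v + unitVec κ) - φ μ y v)) (fun κ₁ v κ₂ v' => bsum L (W κ₁ v κ₂ v')))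
      (CB + (Fintype.card (Fib d) : ℝ) * (aρ * g' * (((d : ℝ) + 1) * (2 * (a * aφ) + aφ * aφ * (Real.exp δ ^ 3 + 1))) *
        (Real.exp κ₀ ^ 5 * Zl (d + 1) (δ / 2) ^ 3 * ((L : ℝ) ^ (d + 1) * Zl (d + 1) (κ₀ / (2 * ((d : ℝ) + 1)))))))
      (κ₀ / 3 / (6 * ((d : ℝ) + 1))) := by
  have hZ2 := Zl_nonneg (D := d + 1) (show 0 < δ / 2 by positivity)
  have hZκ := Zl_nonneg (D := d + 1) (show 0 < κ₀ / (2 * ((d : ℝ) + 1)) by positivity)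
  refine locStencil₂_of_env_bound (by positivity) (by positivity) fun κ u κ' u' x z a₀ b => ?_
  rw [show -(κ₀ / 3 / 6) = -(κ₀ / 18) by ring]
  rcases a₀ with α | ν
  · have h1 := hB κ u κ' u' x z α b
    have h2 := abs_legPush_dressed_sub_inl_le_of_blockL1 hL hκ hδ hgap ha haφ haρ hg hr hφ hl₁ hWb hD₂ hD₁ κ u κ' u' x z α b
    have h3 := abs_sub_abs_le_abs_sub
      (legPush l (fun μ y κ v => r μ y κ v + (φ μ y (v + unitVec κ) - φ μ y v)) (fun κ₁ v κ₂ v' => bsum L (W κ₁ v κ₂ v')) κ u κ' u' x z (Sum.inl α) b)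
      (legPush l r (fun κ₁ v κ₂ v' => bsum L (W κ₁ v κ₂ v')) κ u κ' u' x z (Sum.inl α) b)
    rw [add_mul]
    linarith
  · rw [legPush_inr, abs_zero]; positivity

end DressedBlockL1

section WindowBlockL1

variable {L : ℕ} {κ₀ δ a a' aφ aρ C g g' CW : ℝ}
  {l : Fin (d + 1) → (Fin (d + 1) → ℤ) → Fib d → (Fin (d + 1) → ℤ) → ℝ}
  {r : Fin (d + 1) → (Fin (d + 1) → ℤ) → Fin (d + 1) → (Fin (d + 1) → ℤ) → ℝ}
  {φ : Fin (d + 1) → (Fin (d + 1) → ℤ) → (Fin (d + 1) → ℤ) → ℝ} {W : Tab d}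
  (hL : 1 ≤ L) (hκ : 0 < κ₀) (hδ : 0 < δ) (hgap : κ₀ ≤ δ / 6 * L)
  (ha : 0 ≤ a) (ha' : 0 ≤ a') (haφ : 0 ≤ aφ) (haρ : 0 ≤ aρ) (hg : 0 ≤ g) (hg' : 0 ≤ g')
  (hr : ∀ μ y κ v, |r μ y κ v| ≤ a * Real.exp (-(κ₀ * supNorm (quo L v - y))))
  (hr' : ∀ μ y κ v i, |r μ y κ (v + Pi.single i 1) - r μ y κ v| ≤ a' * Real.exp (-(κ₀ * supNorm (quo L v - y))))
  (hφ : ∀ μ y v, |φ μ y v| ≤ aφ * Real.exp (-(κ₀ * supNorm (quo L v - y))))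
  (hl₁ : ∀ α x' f c, ∑ t ∈ box (d + 1) L, |l α x' f ((L : ℤ) • c + toSite t)| ≤ aρ * (L : ℝ) ^ (d + 1) * Real.exp (-(κ₀ * supNorm (c - x'))))
  (hW : LocStencil₂ W C δ) (hWb : ∀ κ u κ' u' x z a b, |W κ u κ' u' x z a b| ≤ CW)
  (hq₂ : ∀ κ₁ v κ₂ x p f b, |∑' v', W κ₁ v κ₂ v' x p f b| ≤ g * Real.exp (-δ * (l1 (x - v) + l1 (p - v))))
  (hq₁ : ∀ κ₁ κ₂ v' x p f b, |∑' v, W κ₁ v κ₂ v' x p f b| ≤ g * Real.exp (-δ * (l1 (x - v') + l1 (p - v'))))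
  (hq₁₂ : ∀ κ₁ κ₂ x p f b, |∑' v, ∑' v', W κ₁ v κ₂ v' x p f b| ≤ g * Real.exp (-δ * l1 (p - x)))
  (hD₂ : ∀ κ v w x p f b, |∑ μ, (W κ v μ (w - unitVec μ) x p f b - W κ v μ w x p f b)|
    ≤ g' * Real.exp (-δ * l1 (w - v)) * Real.exp (-δ * (l1 (x - v) + l1 (p - v))))
  (hD₁ : ∀ κ' w v' x p f b, |∑ κ, (W κ (w - unitVec κ) κ' v' x p f b - W κ w κ' v' x p f b)|
    ≤ g' * Real.exp (-δ * l1 (v' - w)) * Real.exp (-δ * (l1 (x - w) + l1 (p - w))))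

include hL hκ hδ hgap ha ha' haφ haρ hg hg' hr hr' hφ in
/-- NOT IN PRINT; OUR PROOF.  **THE (E-a) WINDOW, KERNEL LEG IN BLOCK MASS** — `LegPushDressedBound.locStencil₂_legPush_dressed_bsum` VERBATIM (statement and constant)
except `hl ↦ hl₁`; bare part from the OWNER's `LegPushBlockL1.abs_legPush_bsum_inl_le_of_blockL1`, gauge part from this file. -/
theorem locStencil₂_legPush_dressed_bsum_of_blockL1
    (hl₁ : ∀ α x' f c, ∑ t ∈ box (d + 1) L, |l α x' f ((L : ℤ) • c + toSite t)| ≤ aρ * (L : ℝ) ^ (d + 1) * Real.exp (-(κ₀ * supNorm (c - x'))))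
    (hW : LocStencil₂ W C δ)
    (hWb : ∀ κ u κ' u' x z a b, |W κ u κ' u' x z a b| ≤ CW)
    (hq₂ : ∀ κ₁ v κ₂ x p f b, |∑' v', W κ₁ v κ₂ v' x p f b| ≤ g * Real.exp (-δ * (l1 (x - v) + l1 (p - v))))
    (hq₁ : ∀ κ₁ κ₂ v' x p f b, |∑' v, W κ₁ v κ₂ v' x p f b| ≤ g * Real.exp (-δ * (l1 (x - v') + l1 (p - v'))))
    (hq₁₂ : ∀ κ₁ κ₂ x p f b, |∑' v, ∑' v', W κ₁ v κ₂ v' x p f b| ≤ g * Real.exp (-δ * l1 (p - x)))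
    (hD₂ : ∀ κ v w x p f b, |∑ μ, (W κ v μ (w - unitVec μ) x p f b - W κ v μ w x p f b)|
      ≤ g' * Real.exp (-δ * l1 (w - v)) * Real.exp (-δ * (l1 (x - v) + l1 (p - v))))
    (hD₁ : ∀ κ' w v' x p f b, |∑ κ, (W κ (w - unitVec κ) κ' v' x p f b - W κ w κ' v' x p f b)|
      ≤ g' * Real.exp (-δ * l1 (v' - w)) * Real.exp (-δ * (l1 (x - w) + l1 (p - w)))) :
    LocStencil₂ (legPush l (fun μ y κ v => r μ y κ v + (φ μ y (v + unitVec κ) - φ μ y v)) (fun κ₁ v κ₂ v' => bsum L (W κ₁ v κ₂ v')))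
      ((Fintype.card (Fib d) : ℝ) * ((d : ℝ) + 1) ^ 2 *
        (aρ * ((Real.exp κ₀ * Zl (d + 1) (δ / 6)) *
          (a' ^ 2 * C * Real.exp κ₀ ^ 2 * (2 / (δ / 6) * Zl (d + 1) (δ / 6 / 2)) ^ 2
            + 2 * (a * a' * g * Real.exp κ₀ * (2 / (δ / 6) * Zl (d + 1) (δ / 6 / 2))) + a ^ 2 * g)) *
        ((L : ℝ) ^ (d + 1) * Zl (d + 1) (κ₀ / (2 * ((d : ℝ) + 1)))))
       + (Fintype.card (Fib d) : ℝ) * (aρ * g' * (((d : ℝ) + 1) * (2 * (a * aφ) + aφ * aφ * (Real.exp δ ^ 3 + 1))) *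
        (Real.exp κ₀ ^ 5 * Zl (d + 1) (δ / 2) ^ 3 * ((L : ℝ) ^ (d + 1) * Zl (d + 1) (κ₀ / (2 * ((d : ℝ) + 1)))))))
      (κ₀ / 3 / (6 * ((d : ℝ) + 1))) := by
  have hC : 0 ≤ C := hW.nonneg
  have hZ := Zl_nonneg (D := d + 1) (show 0 < δ / 6 by positivity)
  have hZ' := Zl_nonneg (D := d + 1) (show 0 < δ / 6 / 2 by positivity)
  have hZκ := Zl_nonneg (D := d + 1) (show 0 < κ₀ / (2 * ((d : ℝ) + 1)) by positivity)
  exact locStencil₂_legPush_dressed_of_bare_of_blockL1 hL hκ hδ hgap ha haφ haρ hg' hr hφ hl₁ hWb hD₂ hD₁ (by positivity)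
    fun κ u κ' u' x z α b => abs_legPush_bsum_inl_le_of_blockL1 hL hκ hδ hgap ha ha' haρ hg hr hr' hl₁ hW hq₂ hq₁ hq₁₂ κ u κ' u' x z α b

end WindowBlockL1

section ChainBlockL1

variable {K : ℕ → MKer (d + 1) (Fib d)} {N : ℕ} {kc : ℕ → ℝ} {W : Tab d} {C δ : ℝ}
  {L : ℕ} {κ₀ a a' aφ aρ g g' CW : ℝ}
  {r : Fin (d + 1) → (Fin (d + 1) → ℤ) → Fin (d + 1) → (Fin (d + 1) → ℤ) → ℝ}
  {φ : Fin (d + 1) → (Fin (d + 1) → ℤ) → (Fin (d + 1) → ℤ) → ℝ}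

/-- NOT IN PRINT; OUR PROOF.  **THE k₀-FOLD WINDOW MODULO ENVELOPES, DRESSED SLOT LEGS, COMPOSITE KERNEL LEG IN BLOCK MASS** —
`LegChainPushDressed.locStencil₂_legChain_bsumPow_of_dressed_envelopes` VERBATIM except that the composite kernel leg `kChain (krow ∘ K) m k` is only asked to have
block mass `a_ρ·L^{d+1}·e^{−κ₀‖c − x′‖∞}` (the OWNER's `DressedLegBlockL1Envelope` ∕ `DressedLegMultiplierColumnEnvelope` currency). -/
theorem locStencil₂_legChain_bsumPow_of_dressed_envelopes_of_blockL1 (hN : 1 ≤ N) (hK : ∀ j, ∃ C m : ℝ, 0 < m ∧ Decays (K j) C m)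
    (hW : LocStencil₂ W C δ) (hδ : 0 < δ) (m k : ℕ) (hL : L = N ^ (k + 1)) (hκ : 0 < κ₀) (hgap : κ₀ ≤ δ / 6 * L)
    (ha : 0 ≤ a) (ha' : 0 ≤ a') (haφ : 0 ≤ aφ) (haρ : 0 ≤ aρ) (hg : 0 ≤ g) (hg' : 0 ≤ g')
    (hE : Push4Iter.legChain (fun j => colH (K j) N) m k = fun μ y κ v => r μ y κ v + (φ μ y (v + unitVec κ) - φ μ y v))
    (hr : ∀ μ y κ v, |r μ y κ v| ≤ a * Real.exp (-(κ₀ * supNorm (quo L v - y))))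
    (hr' : ∀ μ y κ v i, |r μ y κ (v + Pi.single i 1) - r μ y κ v| ≤ a' * Real.exp (-(κ₀ * supNorm (quo L v - y))))
    (hφ : ∀ μ y v, |φ μ y v| ≤ aφ * Real.exp (-(κ₀ * supNorm (quo L v - y))))
    (hl₁ : ∀ α x' f c, ∑ t ∈ box (d + 1) L, |kChain (fun j => krow (K j) N) m k α x' f ((L : ℤ) • c + toSite t)|
      ≤ aρ * (L : ℝ) ^ (d + 1) * Real.exp (-(κ₀ * supNorm (c - x'))))
    (hWb : ∀ κ u κ' u' x z a b, |W κ u κ' u' x z a b| ≤ CW)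
    (hq₂ : ∀ κ₁ v κ₂ x p f b, |∑' v', W κ₁ v κ₂ v' x p f b| ≤ g * Real.exp (-δ * (l1 (x - v) + l1 (p - v))))
    (hq₁ : ∀ κ₁ κ₂ v' x p f b, |∑' v, W κ₁ v κ₂ v' x p f b| ≤ g * Real.exp (-δ * (l1 (x - v') + l1 (p - v'))))
    (hq₁₂ : ∀ κ₁ κ₂ x p f b, |∑' v, ∑' v', W κ₁ v κ₂ v' x p f b| ≤ g * Real.exp (-δ * l1 (p - x)))
    (hD₂ : ∀ κ v w x p f b, |∑ μ, (W κ v μ (w - unitVec μ) x p f b - W κ v μ w x p f b)|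
      ≤ g' * Real.exp (-δ * l1 (w - v)) * Real.exp (-δ * (l1 (x - v) + l1 (p - v))))
    (hD₁ : ∀ κ' w v' x p f b, |∑ κ, (W κ (w - unitVec κ) κ' v' x p f b - W κ w κ' v' x p f b)|
      ≤ g' * Real.exp (-δ * l1 (v' - w)) * Real.exp (-δ * (l1 (x - w) + l1 (p - w)))) :
    LocStencil₂ (Lin4LegTowerUnroll.legChain kc K N m (k + 1) (fun κ u κ' u' => bsumPow N (k + 1) (W κ u κ' u')))
      (|∏ j ∈ Finset.range (k + 1), kc (m + j)| *
        ((Fintype.card (Fib d) : ℝ) * ((d : ℝ) + 1) ^ 2 *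
          (aρ * ((Real.exp κ₀ * Zl (d + 1) (δ / 6)) *
            (a' ^ 2 * C * Real.exp κ₀ ^ 2 * (2 / (δ / 6) * Zl (d + 1) (δ / 6 / 2)) ^ 2
              + 2 * (a * a' * g * Real.exp κ₀ * (2 / (δ / 6) * Zl (d + 1) (δ / 6 / 2))) + a ^ 2 * g)) *
          ((L : ℝ) ^ (d + 1) * Zl (d + 1) (κ₀ / (2 * ((d : ℝ) + 1)))))
         + (Fintype.card (Fib d) : ℝ) * (aρ * g' * (((d : ℝ) + 1) * (2 * (a * aφ) + aφ * aφ * (Real.exp δ ^ 3 + 1))) *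
          (Real.exp κ₀ ^ 5 * Zl (d + 1) (δ / 2) ^ 3 * ((L : ℝ) ^ (d + 1) * Zl (d + 1) (κ₀ / (2 * ((d : ℝ) + 1))))))))
      (κ₀ / 3 / (6 * ((d : ℝ) + 1))) := by
  have hL1 : 1 ≤ L := by rw [hL]; exact Nat.one_le_pow _ _ hN
  rw [legChain_bsumPow_eq_smul_legPush_bsum hN hK hW hδ m k, ← hL, hE]
  exact locStencil₂_smul' _
    (locStencil₂_legPush_dressed_bsum_of_blockL1 hL1 hκ hδ hgap ha ha' haφ haρ hg hg' hr hr' hφ hl₁ hW hWb hq₂ hq₁ hq₁₂ hD₂ hD₁)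

end ChainBlockL1

end Summit.QuantumFields.BalabanUV.Beta.GAN24.LegPushDressedBoundBlockL1

end
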